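import Summits.BirchSwinnertonDyer.BirchSwinnertonDyer.Theorems.ManinLocalTwoThreeTwoShiftConjDefect
import Summits.BirchSwinnertonDyer.BirchSwinnertonDyer.Theorems.ManinLocalTwoThreeTwoAdicDegeneracyUnitTwistKatoCurve
import HarnessLib

/-!
# The 2-ADIC TWIN, IX: the law E-es-68₈ REMOVED from the Kato-curve road at `p = 2` — `2 ∤ c(W)` on the squarefull `4 ∣ N` cell with
# NO PLUS DEFECT at `2` (reducible `W[2]` allowed) modulo ONLY Kato's printed symbol-closure fact F-es-21♭K
# (route `ManinLocalTwoThree`, cell bsd-f2-manin; crux C2 `ManinOddAtFour` stmt-BirchSwinnertonDyer-22967; prover seat p3 gen 11)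

The seat's gen-9 file `…TwoAdicDegeneracyUnitTwistKatoCurve.lean` proved `2 ∤ D.c` for a lattice-optimal datum of a globally minimal `W` at a
squarefull level `4 ∣ N` with no plus defect at `2`, at KATO'S CURVE `E_K` (`IsSymbolClosureCurve VK D.f`, where Kato's Theorem 12.5 is printed
also for reducible `W[2]`), modulo the Literature fact F-es-21♭K `kato_isIntegral_twistedSymbolSum_two_symbolClosure` AND the cell law E-es-68₈
`DegeneracyLoopLawEight` (`not_two_dvd_maninConstant_of_degeneracyLoopLawEight_symbolClosure`).  With G₈ a theorem (file VI) and the orbit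
criterion at `p = 2` (file VII, `TwoShift.degeneracyEightPlusIndex_of_plusIndexPrimeTo`), the odd ratio-`8` degeneracy plus index follows from
`PlusIndexPrimeTo 2 D.f` alone, so **E-es-68₈ drops out**: `not_two_dvd_maninConstant_of_plusIndexPrimeTo_symbolClosure` (+ the composite-squarefull
variant `'`, where an odd `q² ∣ N` discharges the plus index by the Hecke sieve).  HONEST FRAMING: CONDITIONAL on F-es-21♭K (printed, statement-only
in the tree) and on the Kato-curve binders (`VK`, E-es-63's no-plus-defect hypothesis); C2, Manin's conjecture and BSD are NOT proved.  No
definitions, no sorry.  [cite: Kato2004Asterisque, Thm. 12.5 (1) (p. 221) (the named fact F-es-21♭K, statement-only)]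
-/

set_option linter.dupNamespace false
set_option autoImplicit false

noncomputable section

open scoped Classical MatrixGroups ModularForm ComplexConjugate

open CongruenceSubgroup Complex Literature.NumberTheory.EllipticCurves
  Literature.NumberTheory.EllipticCurves.ModularForms
  Summit.BirchSwinnertonDyer.Rank1Residual.ManinAdditive.Gamma1Lattice
  Summit.BirchSwinnertonDyer.Rank1Residual.ManinAdditive.KatoCurve

namespace Summit.BirchSwinnertonDyer.BirchSwinnertonDyer.Theorems.ManinLocalTwoThree

/-- **`2 ∤ c(W)` at squarefull `4 ∣ N` with NO PLUS DEFECT at `2`, reducible `W[2]` allowed, modulo ONLY F-es-21♭K** (Kato at Kato's curve):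
the plus index `PlusIndexPrimeTo 2 D.f` replaces the cell law E-es-68₈ (via G₈ + the orbit criterion at `p = 2`). CONDITIONAL on the displayed
Literature fact and binders. [cite: Kato2004Asterisque, Thm. 12.5 (1) (p. 221)] -/
theorem not_two_dvd_maninConstant_of_plusIndexPrimeTo_symbolClosure
    (hF : kato_isIntegral_twistedSymbolSum_two_symbolClosure)
    (W : WeierstrassCurve ℚ) [W.IsElliptic] [W.IsGloballyMinimal] {N : ℕ} [NeZero N] (D : ModularParametrizationData W N)
    (hopt : ∀ z ∈ D.L.lattice, ∃ w ∈ periodLattice D.f, z = D.c * w)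
    (h4 : 2 ^ 2 ∣ N) (hsq : ∀ ℓ ∈ N.primeFactors, ℓ ^ 2 ∣ N) (hpi : PlusIndexPrimeTo 2 D.f)
    (hpd : CuspidalPlusDefectPrimeTo 2 D)
    (VK : WeierstrassCurve ℚ) [VK.IsElliptic] [VK.IsGloballyMinimal] (hiso : WeierstrassCurve.IsIsogenous W VK)
    (hK : IsSymbolClosureCurve VK D.f) (hnewK : IsNewformOf VK D.f) (hgK : ¬ VK.HasGoodReductionAtPrime 2)
    (hmK : ¬ VK.HasMultiplicativeReductionAtPrime 2) (haK : ∀ ℓ : ℕ, VK.LFunction ℓ = W.LFunction ℓ) :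
    ¬ (2 : ℤ) ∣ D.c :=
  not_two_dvd_maninConstant_of_degeneracyEightPlusIndex_symbolClosure hF W D hopt h4 hsq
    (TwoShift.degeneracyEightPlusIndex_of_plusIndexPrimeTo D.f D.isNewformOf.1 D.isNewformOf.coeffField_eq_bot hpi)
    hpd VK hiso hK hnewK hgK hmK haK

/-- **Composite squarefull variant** (an odd prime `q` with `q² ∣ N` discharges the plus index by the Hecke sieve `plusIndexPrimeTo_of_sq_dvd`):
`2 ∤ c(W)` modulo ONLY F-es-21♭K on the no-plus-defect composite-squarefull `4 ∣ N` cell. CONDITIONAL. [cite: Kato2004Asterisque, Thm. 12.5 (1) (p. 221)] -/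
theorem not_two_dvd_maninConstant_of_plusIndexPrimeTo_symbolClosure'
    (hF : kato_isIntegral_twistedSymbolSum_two_symbolClosure)
    (W : WeierstrassCurve ℚ) [W.IsElliptic] [W.IsGloballyMinimal] {N : ℕ} [NeZero N] (D : ModularParametrizationData W N)
    (hopt : ∀ z ∈ D.L.lattice, ∃ w ∈ periodLattice D.f, z = D.c * w)
    (h4 : 2 ^ 2 ∣ N) (hsq : ∀ ℓ ∈ N.primeFactors, ℓ ^ 2 ∣ N) {q : ℕ} (hq : q.Prime) (hq2 : q ≠ 2) (hqN : q ^ 2 ∣ N)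
    (hpd : CuspidalPlusDefectPrimeTo 2 D)
    (VK : WeierstrassCurve ℚ) [VK.IsElliptic] [VK.IsGloballyMinimal] (hiso : WeierstrassCurve.IsIsogenous W VK)
    (hK : IsSymbolClosureCurve VK D.f) (hnewK : IsNewformOf VK D.f) (hgK : ¬ VK.HasGoodReductionAtPrime 2)
    (hmK : ¬ VK.HasMultiplicativeReductionAtPrime 2) (haK : ∀ ℓ : ℕ, VK.LFunction ℓ = W.LFunction ℓ) :
    ¬ (2 : ℤ) ∣ D.c :=
  not_two_dvd_maninConstant_of_plusIndexPrimeTo_symbolClosure hF W D hopt h4 hsq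
    (plusIndexPrimeTo_of_sq_dvd D.isNewformOf.1 hq hqN
      fun h ↦ hq2 ((Nat.prime_dvd_prime_iff_eq Nat.prime_two hq).mp h).symm)
    hpd VK hiso hK hnewK hgK hmK haK

end Summit.BirchSwinnertonDyer.BirchSwinnertonDyer.Theorems.ManinLocalTwoThree

end
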